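import Summits.Ventures.PercRepro.C041TriDomExcessWeightedProb
import Summits.Ventures.PercRepro.C041TriDomExcessWeightedHalf
import Summits.Ventures.PercRepro.C041TriDomExcessConvMain

/-!
# ROW C-041 — THE FAIR EXCESS BOUNDS THE WEIGHTED EXCESS FROM BELOW; THE EQUALITY CASE AT EVERY EDGE PROBABILITY
(p6, gen 44; P6-TWOEXIT-LEAN.md §53 ADDENDUM 12)

THE ONE-EDGE MIXTURE IDENTITY (`esymW_mixture`): at a free edge `f` of probability `p = w f`, the weighted
symmetrised excess is EXACTLY `(2p − 1)` times the excess with `f` forced red plus `(2 − 2p)` times the excess with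
`f` made fair (`w f := ½`) — the measure at `p ≥ ½` is the mixture of the point mass «red» and the fair coin (the
inequality `esymW_rec_ge` of `C041TriDomExcessWeighted` is this identity with THE KEY LEMMA applied to the fair
term).  Since every term is non-negative for probabilities in `[½, 1]` (`esymW_nonneg`), making one edge fair costs
at most the factor `2 − 2p` (`esymW_ge_fair_one`; a non-free edge ignores its probability, `esymW_update_nonfree`),
and making every edge fair gives **THEOREM (THE FAIR EXCESS BOUNDS THE WEIGHTED EXCESS)** (`esymP_ge_fair`):
  `E_w[Fsym(π_R, π_B)] ≥ 2 · Π_e (1 − w e) · e(G)`   for all `w e ∈ [½, 1]`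
(`e(G) = excessZ` the fair excess `N_RRa − N_RB − N_WRj − N_RWj`), and by complementation
`E_w[Fsym] ≥ 2 · Π_e w e · e(G)` for all `w e ∈ [0, ½]` (`esymP_ge_fair_of_le_half`).  With THEOREM (EQUALITY CASE):
**on a non-separable host the weighted symmetric excess is at least `2 Π_e (1 − w e)`, positive as soon as no edge
is forced** (`esymP_pos_of_not_separable`); in probabilities, `P(⊤,⊥) + P(⊥,⊤) − Σ_{i≠j} P(s_i,s_j) ≥ 2 Π_e (1 − p_e)`
(`probPat_crossed_add_le_of_not_separable`).  (On a separable host the weighted excess need not vanish for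
`p ≠ ½`: on the path `y–x–z` it is `(2p − 1)²`; the equality locus at `p = ½` is THEOREM (EQUALITY CASE).)
-/

namespace PercRepro

namespace ZoneZ

namespace MultiExit

open ZoneData Finset

variable {V₁ E₁ U₁ U₂ : Type} (Z₁ : ZoneData V₁ E₁ U₁ U₂) (u u' a₁ : V₁)

variable [Fintype E₁] [DecidableEq E₁]

/-! ## The one-edge mixture identity -/

omit Z₁ in
/-- The weight with `f` removed ignores the probability of `f`. -/
theorem cwt'_update (f : E₁) (w : E₁ → ℚ) (c : ℚ) (ω : E₁ → Bool) :
    cwt' f (Function.update w f c) ω = cwt' f w ω := by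
  unfold cwt'
  refine Finset.prod_congr rfl fun e he => ?_
  rw [Function.update_of_ne (Finset.ne_of_mem_erase he)]

/-- **THE ONE-EDGE MIXTURE IDENTITY**: at a free edge `f` of probability `p`, the weighted excess is `(2p − 1)`
times the excess with `f` forced red plus `(2 − 2p)` times the excess with `f` fair. -/
theorem esymW_mixture (R : E₁ → Prop) (st : E₁ → EStat) (w : E₁ → ℚ) (f : E₁) (hf : st f = .free) :
    esymW Z₁ u u' a₁ R st w =
      (2 * w f - 1) * esymW Z₁ u u' a₁ (fun e => R e ∨ e = f) (Function.update st f .absent) w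
        + (2 - 2 * w f) * esymW Z₁ u u' a₁ R st (Function.update w f (1 / 2)) := by
  have hT := two_mul_esymW Z₁ u u' a₁ R st w f hf
  have hT' := two_mul_esymW Z₁ u u' a₁ R st (Function.update w f (1 / 2)) f hf
  have hF := two_mul_esymW_nonfree Z₁ u u' a₁ (fun e => R e ∨ e = f) st w f (s := .absent) (by decide)
  simp only [rsigF_forced_eq Z₁ u u' a₁ R st f] at hF
  simp only [cwt'_update, Function.update_self] at hT'
  have h2 : 2 * esymW Z₁ u u' a₁ R st w =
      (2 * w f - 1) * (2 * esymW Z₁ u u' a₁ (fun e => R e ∨ e = f) (Function.update st f .absent) w)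
        + (2 - 2 * w f) * (2 * esymW Z₁ u u' a₁ R st (Function.update w f (1 / 2))) := by
    rw [hT, hF, hT', Finset.mul_sum, Finset.mul_sum, ← Finset.sum_add_distrib]
    refine Finset.sum_congr rfl fun ω _ => ?_
    ring
  linarith

/-- A non-free edge ignores its probability. -/
theorem esymW_update_nonfree (R : E₁ → Prop) (st : E₁ → EStat) (w : E₁ → ℚ) (f : E₁) (hf : st f ≠ .free)
    (c : ℚ) : esymW Z₁ u u' a₁ R st (Function.update w f c) = esymW Z₁ u u' a₁ R st w := by
  have hst : Function.update st f (st f) = st := Function.update_eq_self f st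
  have h1 := two_mul_esymW_nonfree Z₁ u u' a₁ R st w f hf
  have h2 := two_mul_esymW_nonfree Z₁ u u' a₁ R st (Function.update w f c) f hf
  rw [hst] at h1 h2
  simp only [cwt'_update] at h2
  linarith

/-- Making one edge fair costs at most the factor `2 − 2p` (probabilities in `[½, 1]`). -/
theorem esymW_ge_fair_one (R : E₁ → Prop) (st : E₁ → EStat) (w : E₁ → ℚ) (hw : ∀ e, 1 / 2 ≤ w e ∧ w e ≤ 1)
    (f : E₁) :
    (2 - 2 * w f) * esymW Z₁ u u' a₁ R st (Function.update w f (1 / 2)) ≤ esymW Z₁ u u' a₁ R st w := by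
  by_cases hf : st f = .free
  · rw [esymW_mixture Z₁ u u' a₁ R st w f hf]
    have h1 := esymW_nonneg Z₁ u u' a₁ (fun e => R e ∨ e = f) (Function.update st f .absent) w hw
    have hc : 0 ≤ 2 * w f - 1 := by linarith [(hw f).1]
    nlinarith [mul_nonneg hc h1]
  · rw [esymW_update_nonfree Z₁ u u' a₁ R st w f hf]
    have h0 := esymW_nonneg Z₁ u u' a₁ R st w hw
    have hc : 2 - 2 * w f ≤ 1 := by linarith [(hw f).1]
    nlinarith

/-! ## Making every edge fair -/

/-- The probabilities with the edges of `X` made fair. -/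
def fairOn (w : E₁ → ℚ) (X : Finset E₁) : E₁ → ℚ := fun e => if e ∈ X then 1 / 2 else w e

omit Z₁ [Fintype E₁] in
/-- `fairOn` on an inserted edge is an update. -/
theorem fairOn_insert (w : E₁ → ℚ) (X : Finset E₁) (f : E₁) :
    fairOn w (insert f X) = Function.update (fairOn w X) f (1 / 2) := by
  funext e
  by_cases he : e = f
  · subst he; simp [fairOn]
  · simp [fairOn, he]

omit Z₁ [Fintype E₁] in
/-- Fair edges stay in `[½, 1]`. -/
theorem fairOn_mem (w : E₁ → ℚ) (hw : ∀ e, 1 / 2 ≤ w e ∧ w e ≤ 1) (X : Finset E₁) (e : E₁) :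
    1 / 2 ≤ fairOn w X e ∧ fairOn w X e ≤ 1 := by
  unfold fairOn
  by_cases he : e ∈ X
  · rw [if_pos he]; norm_num
  · rw [if_neg he]; exact hw e

/-- Making the edges of `X` fair costs at most the factor `Π_{e ∈ X} (2 − 2 w e)`. -/
theorem esymW_ge_fairOn (R : E₁ → Prop) (st : E₁ → EStat) (w : E₁ → ℚ) (hw : ∀ e, 1 / 2 ≤ w e ∧ w e ≤ 1)
    (X : Finset E₁) :
    (∏ e ∈ X, (2 - 2 * w e)) * esymW Z₁ u u' a₁ R st (fairOn w X) ≤ esymW Z₁ u u' a₁ R st w := by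
  induction X using Finset.induction_on with
  | empty =>
    have : fairOn w ∅ = w := by funext e; simp [fairOn]
    rw [this, Finset.prod_empty, one_mul]
  | @insert f X hf ih =>
    rw [fairOn_insert, Finset.prod_insert hf]
    have h1 := esymW_ge_fair_one Z₁ u u' a₁ R st (fairOn w X) (fairOn_mem w hw X) f
    have hwf : fairOn w X f = w f := by simp [fairOn, hf]
    rw [hwf] at h1
    have hc : 0 ≤ ∏ e ∈ X, (2 - 2 * w e) :=
      Finset.prod_nonneg fun e _ => by linarith [(hw e).2]
    calc (2 - 2 * w f) * (∏ e ∈ X, (2 - 2 * w e)) * esymW Z₁ u u' a₁ R st (Function.update (fairOn w X) f (1 / 2))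
        = (∏ e ∈ X, (2 - 2 * w e)) * ((2 - 2 * w f) * esymW Z₁ u u' a₁ R st (Function.update (fairOn w X) f (1 / 2))) := by
          ring
      _ ≤ (∏ e ∈ X, (2 - 2 * w e)) * esymW Z₁ u u' a₁ R st (fairOn w X) := mul_le_mul_of_nonneg_left h1 hc
      _ ≤ esymW Z₁ u u' a₁ R st w := ih

/-- The fair weighted excess of the host is `(½)^#E · esym = (½)^#E · 2 · e(G)` (`cwt_half` of
`C041TriDomExcessWeightedHalf`). -/
theorem esymW_half_free :
    esymW Z₁ u u' a₁ (fun _ => False) (fun _ => EStat.free) (fun _ => (1 / 2 : ℚ)) =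
      (1 / 2) ^ Fintype.card E₁ * (2 * (excessZ Z₁ u u' a₁ : ℚ)) := by
  unfold esymW
  simp only [rsigF_false, cwt_half, ← Finset.mul_sum]
  congr 1
  have h := esym_free_eq Z₁ u u' a₁
  unfold esym at h
  exact_mod_cast h

/-- **THEOREM (THE FAIR EXCESS BOUNDS THE WEIGHTED EXCESS)**: for all edge probabilities `w e ∈ [½, 1]`, the
weighted symmetric excess of the host is at least `2 · Π_e (1 − w e)` times the fair excess `e(G)`. -/
theorem esymP_ge_fair (w : E₁ → ℚ) (hw : ∀ e, 1 / 2 ≤ w e ∧ w e ≤ 1) :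
    2 * (∏ e, (1 - w e)) * (excessZ Z₁ u u' a₁ : ℚ) ≤ ∑ ω : E₁ → Bool, cwt w ω *
      (Fsym (rsig Z₁ u u' a₁ (fun _ => EStat.free) ω) (bsig Z₁ u u' a₁ (fun _ => EStat.free) ω) : ℚ) := by
  have h := esymW_ge_fairOn Z₁ u u' a₁ (fun _ => False) (fun _ => EStat.free) w hw Finset.univ
  have hfair : fairOn w Finset.univ = fun _ => (1 / 2 : ℚ) := by funext e; simp [fairOn]
  rw [hfair, esymW_half_free] at h
  have hR : esymW Z₁ u u' a₁ (fun _ => False) (fun _ => EStat.free) w = ∑ ω : E₁ → Bool, cwt w ω *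
      (Fsym (rsig Z₁ u u' a₁ (fun _ => EStat.free) ω) (bsig Z₁ u u' a₁ (fun _ => EStat.free) ω) : ℚ) := by
    unfold esymW
    simp only [rsigF_false]
  rw [hR] at h
  have hprod : (∏ e, (2 - 2 * w e)) * (1 / 2 : ℚ) ^ Fintype.card E₁ = ∏ e, (1 - w e) := by
    rw [← Finset.card_univ, ← Finset.prod_const, ← Finset.prod_mul_distrib]
    refine Finset.prod_congr rfl fun e _ => ?_
    ring
  calc 2 * (∏ e, (1 - w e)) * (excessZ Z₁ u u' a₁ : ℚ)
      = (∏ e, (2 - 2 * w e)) * ((1 / 2) ^ Fintype.card E₁ * (2 * (excessZ Z₁ u u' a₁ : ℚ))) := by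
        rw [← hprod]; ring
    _ ≤ _ := h

/-- **THEOREM (THE FAIR EXCESS BOUNDS THE WEIGHTED EXCESS), `p ≤ ½`**: for all `w e ∈ [0, ½]`, the weighted
symmetric excess is at least `2 · Π_e w e` times the fair excess (complementation). -/
theorem esymP_ge_fair_of_le_half (w : E₁ → ℚ) (hw : ∀ e, 0 ≤ w e ∧ w e ≤ 1 / 2) :
    2 * (∏ e, w e) * (excessZ Z₁ u u' a₁ : ℚ) ≤ ∑ ω : E₁ → Bool, cwt w ω *
      (Fsym (rsig Z₁ u u' a₁ (fun _ => EStat.free) ω) (bsig Z₁ u u' a₁ (fun _ => EStat.free) ω) : ℚ) := by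
  rw [esymP_cpl]
  have h := esymP_ge_fair Z₁ u u' a₁ (fun e => 1 - w e) fun e => ⟨by linarith [(hw e).2], by linarith [(hw e).1]⟩
  simpa only [sub_sub_cancel] using h

/-! ## The equality case at every edge probability -/

/-- The fair excess of a non-separable host is at least one, as an integer. -/
theorem excessZ_ge_one_of_not_separable (h : ¬ SeparableS Z₁ u u' a₁ (fun _ => EStat.free)) :
    1 ≤ excessZ Z₁ u u' a₁ := by
  have h1 := excess_ge_one_of_not_separable Z₁ u u' a₁ h
  rw [excess_eq_excessZ Z₁ u u' a₁] at h1
  exact_mod_cast h1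

/-- **THEOREM (THE WEIGHTED EXCESS OF A NON-SEPARABLE HOST)**: if the marks are connected and no mark separates the
other two, the weighted symmetric excess is at least `2 · Π_e (1 − w e)` for all `w e ∈ [½, 1]` — positive as soon
as no edge is forced. -/
theorem esymP_ge_of_not_separable (h : ¬ SeparableS Z₁ u u' a₁ (fun _ => EStat.free)) (w : E₁ → ℚ)
    (hw : ∀ e, 1 / 2 ≤ w e ∧ w e ≤ 1) :
    2 * (∏ e, (1 - w e)) ≤ ∑ ω : E₁ → Bool, cwt w ω *
      (Fsym (rsig Z₁ u u' a₁ (fun _ => EStat.free) ω) (bsig Z₁ u u' a₁ (fun _ => EStat.free) ω) : ℚ) := by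
  have h1 := esymP_ge_fair Z₁ u u' a₁ w hw
  have h2 : (1 : ℚ) ≤ excessZ Z₁ u u' a₁ := by exact_mod_cast excessZ_ge_one_of_not_separable Z₁ u u' a₁ h
  have hp : 0 ≤ 2 * ∏ e, (1 - w e) := by
    refine mul_nonneg (by norm_num) (Finset.prod_nonneg fun e _ => by linarith [(hw e).2])
  nlinarith

/-- **THEOREM (THE WEIGHTED EXCESS OF A NON-SEPARABLE HOST IS POSITIVE)** for all `w e ∈ [½, 1)`. -/
theorem esymP_pos_of_not_separable (h : ¬ SeparableS Z₁ u u' a₁ (fun _ => EStat.free)) (w : E₁ → ℚ)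
    (hw : ∀ e, 1 / 2 ≤ w e ∧ w e < 1) :
    0 < ∑ ω : E₁ → Bool, cwt w ω *
      (Fsym (rsig Z₁ u u' a₁ (fun _ => EStat.free) ω) (bsig Z₁ u u' a₁ (fun _ => EStat.free) ω) : ℚ) := by
  have h1 := esymP_ge_of_not_separable Z₁ u u' a₁ h w fun e => ⟨(hw e).1, le_of_lt (hw e).2⟩
  have hp : 0 < 2 * ∏ e, (1 - w e) := by
    refine mul_pos (by norm_num) (Finset.prod_pos fun e _ => by linarith [(hw e).2])
  linarith

/-- **THE WEIGHTED EXCESS OF A NON-SEPARABLE HOST, IN PROBABILITIES**: for all `p_e ∈ [½, 1]`,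
`P(s₁,s₂) + P(s₂,s₁) + P(s₁,s₃) + P(s₃,s₁) + P(s₂,s₃) + P(s₃,s₂) + 2 Π_e (1 − p_e) ≤ P(⊤,⊥) + P(⊥,⊤)`. -/
theorem probPat_crossed_add_le_of_not_separable (h : ¬ SeparableS Z₁ u u' a₁ (fun _ => EStat.free))
    (w : E₁ → ℚ) (hw : ∀ e, 1 / 2 ≤ w e ∧ w e ≤ 1) :
    probPat Z₁ u u' a₁ w (true, false, false) (false, true, false)
        + probPat Z₁ u u' a₁ w (false, true, false) (true, false, false)
        + probPat Z₁ u u' a₁ w (true, false, false) (false, false, true)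
        + probPat Z₁ u u' a₁ w (false, false, true) (true, false, false)
        + probPat Z₁ u u' a₁ w (false, true, false) (false, false, true)
        + probPat Z₁ u u' a₁ w (false, false, true) (false, true, false)
        + 2 * (∏ e, (1 - w e)) ≤
      probPat Z₁ u u' a₁ w (true, true, true) (false, false, false)
        + probPat Z₁ u u' a₁ w (false, false, false) (true, true, true) := by
  have h1 := esymP_ge_of_not_separable Z₁ u u' a₁ h w hw
  rw [sum_cwt_Fsym_eq] at h1
  linarith

end MultiExit

end ZoneZ

end PercRepro
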